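import Literature.Algebra.EuclideanLattices.BabaiListProgram
import Literature.Computability.QuantumComplexity.GramSchmidtTableMachine
import HarnessLib

/-!
# Babai's residual is polynomial time (typed `FP` on codes)

Topic `Algebra/EuclideanLattices` (family `pqc`), machine side of `BabaiListProgram.lean` (`Babai.coeffsL`,
`Babai.residualL`: Babai's coefficients and residual as a list program on ONE Cohen table of the extended
rows, agreeing with `intNearestPlane` / `intResidual` on genuine data) on top of
`Computability/QuantumComplexity/GramSchmidtTableMachine.lean` (`levelsOf_codeFP`: Cohen's table is typed
polynomial time; `tabEntry_codeFP`, `column_codeFP`, `dotZ_codeFP`). This is the sub-program of the first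
component of Peikert's `GapSVP → LWE` reduction (`Cryptography/PeikertReduction.lean`, pqc.S20) that turns
the perturbation `w` into the BDD target `x = w - ∑ zᵢbᵢ`. All PROVED; no machine is written:

* `Babai.bsStep ts ds` — one step of the back-substitution fold on the list state `(Λ-row, coefficients)`;
  `iterate_bsStep` — `n` steps compute `backSubL`; `coeffsL_eq_iterate` — hence `coeffsL`;
* `abs_iterate_bsStep_le` — **the one estimate**: along the fold every state integer stays below
  `(A+1)(A+2)^{2t}` (`A` a bound on the table entries), i.e. of polynomial bit-length;
* **`coeffsL_codeFP`**, **`residualL_codeFP`** — `(rows, w) ↦ coeffsL rows w` and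
  `((rows, w), 1ᵐ) ↦ residualL rows w m` are typed polynomial time.

## References

* L. Babai, *On Lovász' lattice reduction and the nearest lattice point problem*, Combinatorica 6 (1986)
  1–13, §3 (the nearest-plane procedure runs in polynomial time) [Babai1986].
* H. Cohen, *A Course in Computational Algebraic Number Theory*, GTM 138, Springer 1993, Algorithm 2.6.7
  and §2.6.3 (all quantities are integers of polynomial size) [Cohen1993].
* S. Arora, B. Barak, *Computational Complexity: A Modern Approach*, CUP 2009, §1.3 [AroraBarak2009].
-/

noncomputable section

namespace Literature.Algebra.EuclideanLattices

open Literature.Computability.Complexity Literature.Computability.Complexity.CodeFP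
  Literature.Computability.QuantumComplexity Polynomial

namespace Babai

/-! ### The fold step and its iteration -/

/-- The coefficient read at one step: `z = roundDiv Λ_{k-1}(w') d_k` for the current row `l` of length `k`
(`d_k = ds[k]`). [cite: Cohen1993, Algorithm 2.6.7] -/
def bsZ (ds : List ℤ) (l : List ℤ) : ℤ := roundDiv (l.getD (l.length - 1) 0) (ds.getD l.length 0)

/-- One entry of the shortened row: `Λⱼ(w') - z Λⱼ(b_{k₁})`, `Λⱼ(b_{k₁}) = T_j(k₁, j)`, `T_j = ts[j]`. [folklore] -/
def bsItem (ts : List (List (List ℤ))) (l : List ℤ) (z : ℤ) (k₁ j : ℕ) : ℤ :=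
  l.getD j 0 - z * tabEntry (ts.getD j []) k₁ j

/-- The shortened row `[Λⱼ(w') - z Λⱼ(b_{k-1}) | j < k - 1]`. [folklore] -/
def bsRow (ts : List (List (List ℤ))) (ds : List ℤ) (l : List ℤ) : List ℤ :=
  (List.range (l.length - 1)).map fun j => bsItem ts l (bsZ ds l) (l.length - 1) j

/-- **One step of the back-substitution fold.** State `(l, zs)`: `l = [Λ₀(w'), …, Λ_{k-1}(w')]` is the
current target row (of the current length `k`), `zs` the coefficients found so far; the step records
`z = bsZ ds l` and shortens the row. [cite: Babai1986, §3; Cohen1993, Algorithm 2.6.7] -/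
def bsStep (ts : List (List (List ℤ))) (ds : List ℤ) (st : List ℤ × List ℤ) : List ℤ × List ℤ :=
  (bsRow ts ds st.1, bsZ ds st.1 :: st.2)

/-- `backSubL k` only reads its data below `k`. [folklore] -/
theorem backSubL_congr : ∀ (k : ℕ) {LB LB' : ℕ → ℕ → ℤ} {LW LW' d d' : ℕ → ℤ}
    (_ : ∀ i j, i < k → j < k → LB i j = LB' i j) (_ : ∀ j, j < k → LW j = LW' j) (_ : ∀ j, j < k → d j = d' j),
    backSubL k LB LW d = backSubL k LB' LW' d'
  | 0, _, _, _, _, _, _, _, _, _ => rfl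
  | k + 1, LB, LB', LW, LW', d, d', hB, hW, hd => by
      rw [backSubL_succ, backSubL_succ, hW k (Nat.lt_succ_self k), hd k (Nat.lt_succ_self k)]
      congr 1
      refine backSubL_congr k (fun i j hi hj => hB i j (by omega) (by omega)) (fun j hj => ?_)
        (fun j hj => hd j (by omega))
      rw [hW j (by omega), hB k j (by omega) (by omega)]

/-- **`k` steps of the fold from a row of length `k` compute `backSubL k`** (and empty the row).
[folklore] -/
theorem iterate_bsStep (ts : List (List (List ℤ))) (ds : List ℤ) :
    ∀ (k : ℕ) (l : List ℤ) (_ : l.length = k) (zs : List ℤ),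
      (bsStep ts ds)^[k] (l, zs) =
        ([], backSubL k (fun i j => tabEntry (ts.getD j []) i j) (fun j => l.getD j 0)
          (fun j => ds.getD (j + 1) 0) ++ zs)
  | 0, l, hl, zs => by
      rw [List.length_eq_zero_iff] at hl
      subst hl
      rfl
  | k + 1, l, hl, zs => by
      rw [Function.iterate_succ_apply]
      have hstep : bsStep ts ds (l, zs) =
          ((List.range k).map fun j =>
              l.getD j 0 - roundDiv (l.getD k 0) (ds.getD (k + 1) 0) * tabEntry (ts.getD j []) k j,
            roundDiv (l.getD k 0) (ds.getD (k + 1) 0) :: zs) := by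
        simp only [bsStep, bsRow, bsItem, bsZ, hl, Nat.add_sub_cancel]
      rw [hstep, iterate_bsStep ts ds k _ (by simp) _, backSubL_succ, List.append_assoc, List.singleton_append]
      congr 1
      refine congrArg₂ _ (backSubL_congr k (fun _ _ _ _ => rfl) (fun j hj => ?_) (fun _ _ => rfl)) rfl
      rw [List.getD_eq_getElem?_getD, List.getElem?_map, List.getElem?_range hj, Option.map_some,
        Option.getD_some]

/-- A left fold over a list of units iterates the step. [folklore] -/
theorem foldl_units_eq_iterate {β : Type*} (f : β → β) : ∀ (l : List Unit) (x : β),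
    l.foldl (fun b _ => f b) x = f^[l.length] x
  | [], _ => rfl
  | _ :: l, x => by rw [List.foldl_cons, List.length_cons, Function.iterate_succ_apply, foldl_units_eq_iterate f l]

/-! ### The tables of the extended rows; the fold's context, initial state and run -/

/-- The levels of the extended rows: `n = |rows|` columns, `n + 1` levels. [folklore] -/
def levelsB (rows : List (List ℤ)) (w : List ℤ) : List (ℤ × List (List ℤ)) :=
  levelsOf (rows ++ [w]) rows.length (rows.length + 1)

/-- There are `n + 1` levels. [folklore] -/
theorem length_levelsB (rows : List (List ℤ)) (w : List ℤ) : (levelsB rows w).length = rows.length + 1 := by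
  rw [levelsB, levelsOf_eq, List.length_map, List.length_range]

/-- The fold's context: `(tables, d's)`. [folklore] -/
def bsCtx (rows : List (List ℤ)) (w : List ℤ) : List (List (List ℤ)) × List ℤ :=
  ((levelsB rows w).map Prod.snd, (levelsB rows w).map Prod.fst)

/-- The initial target row `[T₀(n,0), …, T_{n-1}(n,n-1)]` read off the tables. [folklore] -/
def initRow (ts : List (List (List ℤ))) (n : ℕ) : List ℤ :=
  (List.range n).map fun j => tabEntry (ts.getD j []) n j

/-- The fold's initial state from its context (`n = |ds| - 1`). [folklore] -/
def bsInit (s : List (List (List ℤ)) × List ℤ) : List ℤ × List ℤ := (initRow s.1 (s.2.length - 1), [])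

/-- The fold's run over a list of units. [folklore] -/
def bsFold (s : List (List (List ℤ)) × List ℤ) (us : List Unit) : List ℤ × List ℤ :=
  us.foldl (fun st _ => bsStep s.1 s.2 st) (bsInit s)

/-- **The coefficients are the fold's output**: `n` steps of `bsStep` from the initial row on the tables
of the extended rows. [folklore] -/
theorem coeffsL_eq_bsFold (rows : List (List ℤ)) (w : List ℤ) :
    coeffsL rows w = (bsFold (bsCtx rows w) (List.replicate rows.length ())).2 := by
  set n := rows.length with hn
  set ext := rows ++ [w] with hext
  have hts : (bsCtx rows w).1 = (List.range (n + 1)).map fun t => tableRec ext n t := by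
    simp [bsCtx, levelsB, levelsOf_eq, ← hn, ← hext]
  have hds : (bsCtx rows w).2 = (List.range (n + 1)).map fun t => dList ext n t := by
    simp [bsCtx, levelsB, levelsOf_eq, ← hn, ← hext]
  have hT : ∀ j, j < n + 1 → (bsCtx rows w).1.getD j [] = tableRec ext n j := fun j hj => by
    rw [hts, List.getD_eq_getElem?_getD, List.getElem?_map, List.getElem?_range hj, Option.map_some, Option.getD_some]
  have hD : ∀ j, j < n + 1 → (bsCtx rows w).2.getD j 0 = dList ext n j := fun j hj => by
    rw [hds, List.getD_eq_getElem?_getD, List.getElem?_map, List.getElem?_range hj, Option.map_some, Option.getD_some]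
  have hlen : (bsCtx rows w).2.length - 1 = n := by rw [hds]; simp
  rw [bsFold, foldl_units_eq_iterate, List.length_replicate, bsInit, hlen,
    iterate_bsStep _ _ n _ (by simp [initRow]) [], List.append_nil, coeffsL, ← hn, ← hext]
  refine backSubL_congr n (fun i j _ hj => by rw [hT j (by omega)]) (fun j hj => ?_)
    (fun j hj => by rw [hD (j + 1) (by omega)])
  rw [initRow, List.getD_eq_getElem?_getD, List.getElem?_map, List.getElem?_range hj, Option.map_some,
    Option.getD_some, hT j (by omega)]

/-! ### The one estimate: the state integers along the fold -/

/-- `|roundDiv a d| ≤ 2|a| + |d|`. [folklore] -/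
theorem natAbs_roundDiv_le (a d : ℤ) : (roundDiv a d).natAbs ≤ 2 * a.natAbs + d.natAbs := by
  unfold roundDiv
  refine (Int.natAbs_ediv_le_natAbs _ _).trans ?_
  calc (2 * a + d).natAbs ≤ (2 * a).natAbs + d.natAbs := Int.natAbs_add_le _ _
    _ = 2 * a.natAbs + d.natAbs := by rw [Int.natAbs_mul]; rfl

/-- **The state integers stay small along the fold.** If every table entry `T_j(i, j')` and every `d`
read is bounded by `A` in absolute value, and every integer of the initial state is, then after `t` steps
every state integer `x` has `|x| + 1 ≤ (A + 1)(A + 2)^{2t}`. [cite: Cohen1993, §2.6.3] -/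
theorem abs_iterate_bsStep_le (ts : List (List (List ℤ))) (ds : List ℤ) {A : ℕ}
    (hT : ∀ i j k, (tabEntry (ts.getD k []) i j).natAbs ≤ A) (hd : ∀ k, (ds.getD k 0).natAbs ≤ A) :
    ∀ (t : ℕ) (st : List ℤ × List ℤ) (_ : ∀ x ∈ st.1 ++ st.2, x.natAbs ≤ A),
      ∀ x ∈ ((bsStep ts ds)^[t] st).1 ++ ((bsStep ts ds)^[t] st).2, x.natAbs + 1 ≤ (A + 1) * (A + 2) ^ (2 * t)
  | 0, st, hst, x, hx => by simpa using hst x hx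
  | t + 1, st, hst, x, hx => by
      rw [Function.iterate_succ_apply'] at hx
      set st' := (bsStep ts ds)^[t] st with hst'
      have ih := abs_iterate_bsStep_le ts ds hT hd t st hst
      set B := (A + 1) * (A + 2) ^ (2 * t) with hB
      have hB1 : 1 ≤ B := by rw [hB]; exact Nat.one_le_iff_ne_zero.2 (by positivity)
      have hgetD : ∀ j, (st'.1.getD j 0).natAbs + 1 ≤ B := fun j => by
        rw [List.getD_eq_getElem?_getD]
        cases h : st'.1[j]? with
        | none => simpa using hB1
        | some v => exact ih v (List.mem_append_left _ (List.mem_of_getElem? h))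
      -- the new coefficient
      have hzle : (bsZ ds st'.1).natAbs + 1 ≤ 2 * B + A := by
        have h1 := natAbs_roundDiv_le (st'.1.getD (st'.1.length - 1) 0) (ds.getD st'.1.length 0)
        have h2 := hgetD (st'.1.length - 1)
        have h3 := hd st'.1.length
        rw [bsZ]
        omega
      have hpow : (A + 1) * (A + 2) ^ (2 * (t + 1)) = B * (A + 2) ^ 2 := by rw [hB]; ring
      rw [hpow]
      have hexp : B * (A + 2) ^ 2 = A * A * B + 4 * (A * B) + 4 * B := by ring
      have hAB : A ≤ A * B := Nat.le_mul_of_pos_right A hB1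
      have hAAB : A * A ≤ A * A * B := Nat.le_mul_of_pos_right _ hB1
      have hsq : 2 * B + A ≤ B * (A + 2) ^ 2 := by rw [hexp]; omega
      simp only [bsStep, bsRow, List.mem_append, List.mem_map, List.mem_range, List.mem_cons] at hx
      rcases hx with ⟨j, _, rfl⟩ | rfl | hx
      · -- a new row entry `x - z e`
        rw [bsItem]
        set e := tabEntry (ts.getD j []) (st'.1.length - 1) j with he
        set z := bsZ ds st'.1 with hz
        have h1 := hgetD j
        have h2 : e.natAbs ≤ A := hT _ _ _
        have h3 : (st'.1.getD j 0 - z * e).natAbs ≤ (st'.1.getD j 0).natAbs + z.natAbs * e.natAbs := by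
          rw [← Int.natAbs_mul]; exact Int.natAbs_sub_le _ _
        have h4 : z.natAbs * e.natAbs ≤ (2 * B + A) * A := Nat.mul_le_mul (by omega) h2
        have h5 : (2 * B + A) * A + B ≤ B * (A + 2) ^ 2 := by
          rw [hexp, add_mul, show 2 * B * A = 2 * (A * B) by ring]
          omega
        omega
      · exact hzle.trans hsq
      · exact (ih x (List.mem_append_right _ hx)).trans (by rw [hexp]; omega)

/-- The state lists stay short: `|l| + |zs| ≤ |l₀| + |zs₀| + t`. [folklore] -/
theorem length_iterate_bsStep_le (ts : List (List (List ℤ))) (ds : List ℤ) :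
    ∀ (t : ℕ) (st : List ℤ × List ℤ),
      ((bsStep ts ds)^[t] st).1.length + ((bsStep ts ds)^[t] st).2.length ≤ st.1.length + st.2.length + t
  | 0, st => by simp
  | t + 1, st => by
      rw [Function.iterate_succ_apply']
      have ih := length_iterate_bsStep_le ts ds t st
      simp only [bsStep, bsRow, List.length_map, List.length_range, List.length_cons]
      omega

/-! ### Sizes of the codes -/

/-- A default lookup is the default or a member. [folklore] -/
theorem getD_eq_or_mem {α : Type*} (l : List α) (i : ℕ) (d : α) : l.getD i d = d ∨ l.getD i d ∈ l := by
  rw [List.getD_eq_getElem?_getD]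
  cases h : l[i]? with
  | none => exact Or.inl rfl
  | some a => exact Or.inr (List.mem_of_getElem? h)

/-- An entry of a table of the coded list `ts` is short: `|e| < 2^{|code ts|}`. [folklore] -/
theorem natAbs_tabEntry_getD_lt (ts : List (List (List ℤ))) (i j k : ℕ) :
    (tabEntry (ts.getD k []) i j).natAbs < 2 ^ (rawE (rawE (rawE intE)) ts).length := by
  have hT := getD_eq_or_mem ts k ([] : List (List ℤ))
  have hr := getD_eq_or_mem (ts.getD k []) i ([] : List ℤ)
  have he := getD_eq_or_mem ((ts.getD k []).getD i []) j (0 : ℤ)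
  show (((ts.getD k []).getD i []).getD j 0).natAbs < _
  rcases he with h0 | hmem
  · rw [h0]; exact Nat.two_pow_pos _
  refine (natAbs_lt_two_pow_length_intE _).trans_le (Nat.pow_le_pow_right two_pos ?_)
  have h1 := length_item_le_length_rawE intE hmem
  rcases hr with hr0 | hrT
  · rw [hr0] at hmem; simp at hmem
  have h2 := length_item_le_length_rawE (rawE intE) hrT
  rcases hT with hT0 | hTts
  · rw [hT0] at hrT; simp at hrT
  have h3 := length_item_le_length_rawE (rawE (rawE intE)) hTts
  omega

/-- An entry of the coded list `ds` is short: `|d| < 2^{|code ds|}`. [folklore] -/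
theorem natAbs_getD_lt (ds : List ℤ) (k : ℕ) : (ds.getD k 0).natAbs < 2 ^ (rawE intE ds).length := by
  rcases getD_eq_or_mem ds k 0 with h0 | hmem
  · rw [h0]; exact Nat.two_pow_pos _
  refine (natAbs_lt_two_pow_length_intE _).trans_le (Nat.pow_le_pow_right two_pos ?_)
  have := length_item_le_length_rawE intE hmem
  omega

/-! ### Typed polynomial time -/

/-- The context code `⟨tables, d's⟩`. [folklore] -/
abbrev bsCtxE : List (List (List ℤ)) × List ℤ → List Bool := pairE (rawE (rawE (rawE intE))) (rawE intE)

/-- The state code `⟨row, coefficients⟩`. [folklore] -/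
abbrev bsStateE : List ℤ × List ℤ → List Bool := pairE (rawE intE) (rawE intE)

/-- `roundDiv` is typed polynomial time. [folklore] -/
theorem roundDiv_codeFP : CodeFP (pairE intE intE) intE (fun p => roundDiv p.1 p.2) := by
  have h2a : CodeFP (pairE intE intE) intE (fun p => 2 * p.1) := (intMul.comp ((const _ (2 : ℤ)).pair (fst _ _)) :)
  have h2d : CodeFP (pairE intE intE) intE (fun p => 2 * p.2) := (intMul.comp ((const _ (2 : ℤ)).pair (snd _ _)) :)
  have h := (intEDiv.comp ((intAdd.comp (h2a.pair (snd _ _))).pair h2d) :)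
  exact h.congr fun p => rfl

/-- `bsZ` is typed polynomial time on `(ds, l)`. [folklore] -/
theorem bsZ_codeFP : CodeFP (pairE (rawE intE) (rawE intE)) intE (fun p => bsZ p.1 p.2) := by
  have hk : CodeFP (pairE (rawE intE) (rawE intE)) natE (fun p => p.2.length) := ((natLength intE).comp (snd _ _) :)
  have hk1 : CodeFP (pairE (rawE intE) (rawE intE)) natE (fun p => p.2.length - 1) := (natSub.comp (hk.pair (const _ 1)) :)
  have ha : CodeFP (pairE (rawE intE) (rawE intE)) intE (fun p => p.2.getD (p.2.length - 1) 0) :=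
    ((rawGetOr intE).comp ((snd _ _).pair (hk1.pair (const _ (0 : ℤ)))) :)
  have hd : CodeFP (pairE (rawE intE) (rawE intE)) intE (fun p => p.1.getD p.2.length 0) :=
    ((rawGetOr intE).comp ((fst _ _).pair (hk.pair (const _ (0 : ℤ)))) :)
  have h := (roundDiv_codeFP.comp (ha.pair hd) :)
  exact h.congr fun p => rfl

/-- The argument code of `bsItem`: `⟨⟨ts, ⟨l, ⟨z, k₁⟩⟩⟩, j⟩`. [folklore] -/
abbrev bsItemE : (List (List (List ℤ)) × (List ℤ × (ℤ × ℕ))) × ℕ → List Bool :=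
  pairE (pairE (rawE (rawE (rawE intE))) (pairE (rawE intE) (pairE intE natE))) natE

/-- `bsItem` is typed polynomial time. [folklore] -/
theorem bsItem_codeFP : CodeFP bsItemE intE (fun q => bsItem q.1.1 q.1.2.1 q.1.2.2.1 q.1.2.2.2 q.2) := by
  have qts : CodeFP bsItemE (rawE (rawE (rawE intE))) (fun q => q.1.1) := (fst _ _).fst'
  have ql : CodeFP bsItemE (rawE intE) (fun q => q.1.2.1) := (fst _ _).snd'.fst'
  have qz : CodeFP bsItemE intE (fun q => q.1.2.2.1) := (fst _ _).snd'.snd'.fst'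
  have qk : CodeFP bsItemE natE (fun q => q.1.2.2.2) := (fst _ _).snd'.snd'.snd'
  have qj : CodeFP bsItemE natE (fun q => q.2) := snd _ _
  have qT : CodeFP bsItemE (rawE (rawE intE)) (fun q => q.1.1.getD q.2 []) :=
    ((rawGetD (rawE (rawE intE)) (d := ([] : List (List ℤ))) rfl).comp (qts.pair qj) :)
  have qe : CodeFP bsItemE intE (fun q => tabEntry (q.1.1.getD q.2 []) q.1.2.2.2 q.2) :=
    (tabEntry_codeFP.comp (qT.pair (qk.pair qj)) :)
  have qx : CodeFP bsItemE intE (fun q => q.1.2.1.getD q.2 0) := ((rawGetOr intE).comp (ql.pair (qj.pair (const _ (0 : ℤ)))) :)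
  have h := (intSub.comp (qx.pair (intMul.comp (qz.pair qe))) :)
  exact h.congr fun q => rfl

/-- `bsRow` is typed polynomial time on `(ts, (ds, l))`. [folklore] -/
theorem bsRow_codeFP : CodeFP (pairE (rawE (rawE (rawE intE))) (pairE (rawE intE) (rawE intE))) (rawE intE)
    (fun p => bsRow p.1 p.2.1 p.2.2) := by
  have hts : CodeFP (pairE (rawE (rawE (rawE intE))) (pairE (rawE intE) (rawE intE))) (rawE (rawE (rawE intE)))
      (fun p => p.1) := fst _ _
  have hl : CodeFP (pairE (rawE (rawE (rawE intE))) (pairE (rawE intE) (rawE intE))) (rawE intE) (fun p => p.2.2) :=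
    (snd _ _).snd'
  have hz : CodeFP (pairE (rawE (rawE (rawE intE))) (pairE (rawE intE) (rawE intE))) intE (fun p => bsZ p.2.1 p.2.2) :=
    (bsZ_codeFP.comp (snd _ _) :)
  have hk1 : CodeFP (pairE (rawE (rawE (rawE intE))) (pairE (rawE intE) (rawE intE))) natE (fun p => p.2.2.length - 1) :=
    (natSub.comp ((((natLength intE).comp hl)).pair (const _ 1)) :)
  have hu' := (unOfNatMin.comp (((ulength intE).comp hl).pair hk1) :)
  have hu : CodeFP (pairE (rawE (rawE (rawE intE))) (pairE (rawE intE) (rawE intE))) unE (fun p => p.2.2.length - 1) :=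
    hu'.congr fun p => min_eq_left (Nat.sub_le _ _)
  have hctx : CodeFP (pairE (rawE (rawE (rawE intE))) (pairE (rawE intE) (rawE intE)))
      (pairE (rawE (rawE (rawE intE))) (pairE (rawE intE) (pairE intE natE))) (fun p => (p.1, (p.2.2, (bsZ p.2.1 p.2.2, p.2.2.length - 1)))) :=
    (hts.pair (hl.pair (hz.pair hk1)) :)
  have h := ((map bsItem_codeFP).comp (hctx.pair (urange.comp hu)) :)
  exact h.congr fun p => rfl

/-- **The fold step is typed polynomial time** (context `(ts, ds)`, a unit item, the state). [folklore] -/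
theorem bsStep_codeFP : CodeFP (pairE bsCtxE (pairE unitE bsStateE)) bsStateE (fun t => bsStep t.1.1 t.1.2 t.2.2) := by
  have hts : CodeFP (pairE bsCtxE (pairE unitE bsStateE)) (rawE (rawE (rawE intE))) (fun t => t.1.1) := (fst _ _).fst'
  have hds : CodeFP (pairE bsCtxE (pairE unitE bsStateE)) (rawE intE) (fun t => t.1.2) := (fst _ _).snd'
  have hl : CodeFP (pairE bsCtxE (pairE unitE bsStateE)) (rawE intE) (fun t => t.2.2.1) := (snd _ _).snd'.fst'
  have hzs : CodeFP (pairE bsCtxE (pairE unitE bsStateE)) (rawE intE) (fun t => t.2.2.2) := (snd _ _).snd'.snd'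
  have hrow : CodeFP (pairE bsCtxE (pairE unitE bsStateE)) (rawE intE) (fun t => bsRow t.1.1 t.1.2 t.2.2.1) :=
    (bsRow_codeFP.comp (hts.pair (hds.pair hl)) :)
  have hz : CodeFP (pairE bsCtxE (pairE unitE bsStateE)) intE (fun t => bsZ t.1.2 t.2.2.1) := (bsZ_codeFP.comp (hds.pair hl) :)
  have h := (hrow.pair ((rawCons intE).comp (hz.pair hzs)) :)
  exact h.congr fun t => rfl

/-- **The initial state is typed polynomial time.** [folklore] -/
theorem bsInit_codeFP : CodeFP bsCtxE bsStateE bsInit := by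
  have hn : CodeFP bsCtxE natE (fun s => s.2.length - 1) := (natSub.comp (((natLength intE).comp (snd _ _)).pair (const _ 1)) :)
  have hun' := (unOfNatMin.comp (((ulength intE).comp (snd _ _)).pair hn) :)
  have hun : CodeFP bsCtxE unE (fun s => s.2.length - 1) := hun'.congr fun s => min_eq_left (Nat.sub_le _ _)
  have hitem : CodeFP (pairE (pairE (rawE (rawE (rawE intE))) natE) natE) intE
      (fun q => tabEntry (q.1.1.getD q.2 []) q.1.2 q.2) :=
    (tabEntry_codeFP.comp (((rawGetD (rawE (rawE intE)) (d := ([] : List (List ℤ))) rfl).comp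
      ((fst _ _).fst'.pair (snd _ _))).pair ((fst _ _).snd'.pair (snd _ _))) :)
  have hrow' := ((map hitem).comp (((fst _ _).pair hn).pair (urange.comp hun)) :)
  have hrow : CodeFP bsCtxE (rawE intE) (fun s => initRow s.1 (s.2.length - 1)) := hrow'.congr fun s => rfl
  have hnil : CodeFP bsCtxE (rawE intE) (fun _ => ([] : List ℤ)) := const _ _
  have h := (hrow.pair hnil :)
  exact h.congr fun s => rfl

/-- **The size of the fold's state along the run** is polynomial (`≤ 91 (L + 2)³` in the input length `L`).
[cite: Cohen1993, §2.6.3] -/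
theorem length_bsState_le (s : List (List (List ℤ)) × List ℤ) (l₁ l₂ : List Unit) :
    (bsStateE (l₁.foldl (fun st (_ : Unit) => bsStep s.1 s.2 st) (bsInit s))).length ≤
      (91 * (X + 2) ^ 3 : Polynomial ℕ).eval (pairE bsCtxE (rawE unitE) (s, l₁ ++ l₂)).length := by
  obtain ⟨ts, ds⟩ := s
  set L := (pairE bsCtxE (rawE unitE) ((ts, ds), l₁ ++ l₂)).length with hL
  set a := (bsCtxE (ts, ds)).length with ha
  set t := l₁.length with ht
  have hLeq : L = 2 * a + 2 + (rawE unitE (l₁ ++ l₂)).length := by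
    rw [hL, ha, pairE_apply, length_boolPair]
  have haeq : a = 2 * (rawE (rawE (rawE intE)) ts).length + 2 + (rawE intE ds).length := by
    rw [ha, show bsCtxE (ts, ds) = pairE (rawE (rawE (rawE intE))) (rawE intE) (ts, ds) from rfl, pairE_apply,
      length_boolPair]
  have hul : l₁.length + l₂.length ≤ (rawE unitE (l₁ ++ l₂)).length := by
    rw [← List.length_append]; exact length_le_length_rawE unitE _
  have haL : a ≤ L := by omega
  have htL : t ≤ L := by omega
  have hats : (rawE (rawE (rawE intE)) ts).length ≤ a := by omega
  have hads : (rawE intE ds).length ≤ a := by omega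
  -- the entry bound `A = 2^a - 1`
  have hA1 : 1 ≤ 2 ^ a := Nat.one_le_two_pow
  have hT : ∀ i j k, (tabEntry (ts.getD k []) i j).natAbs ≤ 2 ^ a - 1 := fun i j k => by
    have := (natAbs_tabEntry_getD_lt ts i j k).trans_le (Nat.pow_le_pow_right two_pos hats)
    omega
  have hd : ∀ k, (ds.getD k 0).natAbs ≤ 2 ^ a - 1 := fun k => by
    have := (natAbs_getD_lt ds k).trans_le (Nat.pow_le_pow_right two_pos hads)
    omega
  have hinit : ∀ x ∈ (bsInit (ts, ds)).1 ++ (bsInit (ts, ds)).2, x.natAbs ≤ 2 ^ a - 1 := by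
    intro x hx
    simp only [bsInit, List.append_nil, initRow, List.mem_map, List.mem_range] at hx
    obtain ⟨j, _, rfl⟩ := hx
    exact hT _ _ _
  rw [foldl_units_eq_iterate (bsStep ts ds) l₁, ← ht]
  set st := (bsStep ts ds)^[t] (bsInit (ts, ds)) with hst
  -- every state integer is below `2^{(a+1)(2t+1)}`
  have hW : ∀ x ∈ st.1 ++ st.2, x.natAbs < 2 ^ ((a + 1) * (2 * t + 1)) := by
    intro x hx
    have h := abs_iterate_bsStep_le ts ds hT hd t _ hinit x hx
    have h1 : (2 ^ a - 1 + 1) * (2 ^ a - 1 + 2) ^ (2 * t) ≤ 2 ^ ((a + 1) * (2 * t + 1)) := by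
      rw [Nat.sub_add_cancel hA1, show 2 ^ a - 1 + 2 = 2 ^ a + 1 by omega]
      calc 2 ^ a * (2 ^ a + 1) ^ (2 * t) ≤ 2 ^ (a + 1) * (2 ^ (a + 1)) ^ (2 * t) := by
            apply Nat.mul_le_mul (Nat.pow_le_pow_right two_pos (Nat.le_succ a))
            apply Nat.pow_le_pow_left
            rw [pow_succ]; omega
        _ = 2 ^ ((a + 1) * (2 * t + 1)) := by rw [← pow_mul, ← pow_add]; ring_nf
    omega
  have hE : ∀ x ∈ st.1 ++ st.2, (intE x).length ≤ 3 * ((a + 1) * (2 * t + 1)) + 2 := fun x hx =>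
    length_intE_le_of_natAbs_lt (hW x hx)
  -- lengths of the two lists
  have hlen : st.1.length + st.2.length ≤ a + t := by
    have h := length_iterate_bsStep_le ts ds t (bsInit (ts, ds))
    rw [← hst] at h
    have h0 : (bsInit (ts, ds)).1.length + (bsInit (ts, ds)).2.length = ds.length - 1 := by
      simp [bsInit, initRow]
    have : ds.length ≤ a := (length_le_length_rawE intE ds).trans hads
    omega
  -- assemble
  set E := 3 * ((a + 1) * (2 * t + 1)) + 2 with hEdef
  have h1 : (rawE intE st.1).length ≤ st.1.length * (2 * E + 2) :=
    length_rawE_le_of_forall intE fun x hx => hE x (List.mem_append_left _ hx)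
  have h2 : (rawE intE st.2).length ≤ st.2.length * (2 * E + 2) :=
    length_rawE_le_of_forall intE fun x hx => hE x (List.mem_append_right _ hx)
  have hcode : (bsStateE st).length = 2 * (rawE intE st.1).length + 2 + (rawE intE st.2).length := by
    rw [show bsStateE st = pairE (rawE intE) (rawE intE) (st.1, st.2) from rfl, pairE_apply, length_boolPair]
  rw [hcode, eval_mul, eval_pow, eval_add, eval_X, eval_ofNat, eval_ofNat]
  have h12 : (rawE intE st.1).length + (rawE intE st.2).length ≤ (a + t) * (2 * E + 2) := by
    have := Nat.add_le_add h1 h2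
    rw [← Nat.add_mul] at this
    exact this.trans (Nat.mul_le_mul_right _ hlen)
  have hE' : 2 * E + 2 ≤ 15 * (L + 2) ^ 2 := by
    rw [hEdef]
    have : (a + 1) * (2 * t + 1) ≤ (L + 2) * (2 * (L + 2)) := Nat.mul_le_mul (by omega) (by omega)
    nlinarith
  have hat : a + t ≤ 2 * (L + 2) := by omega
  calc 2 * (rawE intE st.1).length + 2 + (rawE intE st.2).length
      ≤ 2 * ((a + t) * (2 * E + 2)) + 2 := by omega
    _ ≤ 2 * (2 * (L + 2) * (15 * (L + 2) ^ 2)) + 2 :=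
        Nat.add_le_add_right (Nat.mul_le_mul_left 2 (Nat.mul_le_mul hat hE')) 2
    _ ≤ 91 * (L + 2) ^ 3 := by nlinarith

/-- **The fold's run is typed polynomial time.** [cite: AroraBarak2009, §1.3] -/
theorem bsFold_codeFP : CodeFP (pairE bsCtxE (rawE unitE)) bsStateE (fun p => bsFold p.1 p.2) := by
  have hstep : CodeFP (pairE bsCtxE (pairE unitE bsStateE)) bsStateE
      (fun t => (fun (s : List (List (List ℤ)) × List ℤ) (_ : Unit) (st : List ℤ × List ℤ) => bsStep s.1 s.2 st) t.1 t.2.1 t.2.2) :=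
    bsStep_codeFP.congr fun t => rfl
  have h := foldl (σ := List (List (List ℤ)) × List ℤ) (α := Unit) (β := List ℤ × List ℤ) (eσ := bsCtxE) (eα := unitE)
    (eβ := bsStateE) (step := fun s _ st => bsStep s.1 s.2 st) (init := bsInit) hstep bsInit_codeFP (91 * (X + 2) ^ 3)
    (fun s l₁ l₂ => length_bsState_le s l₁ l₂)
  exact h.congr fun p => rfl

/-- The context is typed polynomial time on `(rows, w)`. [folklore] -/
theorem bsCtx_codeFP : CodeFP (pairE (rawE (rawE intE)) (rawE intE)) bsCtxE (fun p => bsCtx p.1 p.2) := by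
  have hn : CodeFP (pairE (rawE (rawE intE)) (rawE intE)) unE (fun p => p.1.length) := ((ulength _).comp (fst _ _) :)
  have hext : CodeFP (pairE (rawE (rawE intE)) (rawE intE)) (rawE (rawE intE)) (fun p => p.1 ++ [p.2]) :=
    ((rawAppend _).comp ((fst _ _).pair ((rawSingleton _).comp (snd _ _))) :)
  have hlev' := (levelsOf_codeFP.comp ((unSucc.comp hn).pair (hn.pair hext)) :)
  have hlev : CodeFP (pairE (rawE (rawE intE)) (rawE intE)) (rawE (pairE intE (rawE (rawE intE))))
      (fun p => levelsB p.1 p.2) := hlev'.congr fun p => rfl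
  have h := ((((map₀ (snd intE (rawE (rawE intE)))).comp hlev).pair ((map₀ (fst intE (rawE (rawE intE)))).comp hlev)) :)
  exact h.congr fun p => rfl

/-- **Babai's coefficients are typed polynomial time**: `(rows, w) ↦ coeffsL rows w`.
[cite: Babai1986, §3; AroraBarak2009, §1.3] -/
theorem coeffsL_codeFP : CodeFP (pairE (rawE (rawE intE)) (rawE intE)) (rawE intE) (fun p => coeffsL p.1 p.2) := by
  have hunits : CodeFP (pairE (rawE (rawE intE)) (rawE intE)) (rawE unitE) (fun p => List.replicate p.1.length ()) :=
    (replicateUnit.comp ((ulength _).comp (fst _ _)) :)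
  have hrun' := (bsFold_codeFP.comp (bsCtx_codeFP.pair hunits) :)
  have hrun : CodeFP (pairE (rawE (rawE intE)) (rawE intE)) bsStateE
      (fun p => bsFold (bsCtx p.1 p.2) (List.replicate p.1.length ())) := hrun'.congr fun p => rfl
  exact hrun.snd'.congr fun p => (coeffsL_eq_bsFold p.1 p.2).symm

/-- The argument code of one residual coordinate: `⟨⟨⟨rows, w⟩, zs⟩, t⟩`. [folklore] -/
abbrev resItemE : ((List (List ℤ) × List ℤ) × List ℤ) × ℕ → List Bool :=
  pairE (pairE (pairE (rawE (rawE intE)) (rawE intE)) (rawE intE)) natE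

/-- One residual coordinate `w_t - ⟨zs, column t⟩` is typed polynomial time. [folklore] -/
theorem resItem_codeFP : CodeFP resItemE intE (fun q => q.1.1.2.getD q.2 0 - dotZ q.1.2 (q.1.1.1.map fun r => r.getD q.2 0)) := by
  have qw : CodeFP resItemE (rawE intE) (fun q => q.1.1.2) := (fst _ _).fst'.snd'
  have qrows : CodeFP resItemE (rawE (rawE intE)) (fun q => q.1.1.1) := (fst _ _).fst'.fst'
  have qzs : CodeFP resItemE (rawE intE) (fun q => q.1.2) := (fst _ _).snd'
  have qt : CodeFP resItemE natE (fun q => q.2) := snd _ _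
  have hcol : CodeFP resItemE (rawE intE) (fun q => q.1.1.1.map fun r => r.getD q.2 0) := (column_codeFP.comp (qrows.pair qt) :)
  have h := (intSub.comp (((rawGetOr intE).comp (qw.pair (qt.pair (const _ (0 : ℤ))))).pair
    (dotZ_codeFP.comp (qzs.pair hcol))) :)
  exact h.congr fun q => rfl

/-- **Babai's residual is typed polynomial time**: `((rows, w), 1ᵐ) ↦ residualL rows w m`.
[cite: Babai1986, §3; AroraBarak2009, §1.3] -/
theorem residualL_codeFP :
    CodeFP (pairE (pairE (rawE (rawE intE)) (rawE intE)) unE) (rawE intE) (fun p => residualL p.1.1 p.1.2 p.2) := by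
  have hzs : CodeFP (pairE (pairE (rawE (rawE intE)) (rawE intE)) unE) (rawE intE) (fun p => coeffsL p.1.1 p.1.2) :=
    (coeffsL_codeFP.comp (fst _ _) :)
  have h := ((map resItem_codeFP).comp (((fst _ _).pair hzs).pair (urange.comp (snd _ _))) :)
  exact h.congr fun p => rfl

end Babai

end Literature.Algebra.EuclideanLattices

end
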